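import Summits.AtomisticToContinuum.HydrodynamicLimit.Theses.TwoClocks
import Summits.AtomisticToContinuum.HydrodynamicLimit.Theorems.TransferActivityTails.Negative.EquilibriumReduction
import Summits.AtomisticToContinuum.HydrodynamicLimit.Theorems.TwoClocksTransferActivityTailsDriftTransferFixedN
import Summits.AtomisticToContinuum.HydrodynamicLimit.Theorems.TwoClocksTransferActivityTailsDriftEngine
import Summits.AtomisticToContinuum.HydrodynamicLimit.Theorems.TwoClocksTransferActivityTailsBlockActAEMeasurable
import Summits.AtomisticToContinuum.HydrodynamicLimit.Theorems.TwoClocksTransferActivityTailsBlockAverage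
import Summits.AtomisticToContinuum.HydrodynamicLimit.Theorems.TwoClocksTransferActivityTailsWindowSandwich
import Literature.MathematicalPhysics.KineticTheory.HardSphereEulerLLN
import HarnessLib

/-!
# `TransferActivityTails` (stmt-AtomisticToContinuum-16624), line `Sketch` (card `predictor-drift-doob`):
# the transfer (registered stub `stub_driftTransfer`; file 3 of 3)

Helper file (`--supports stmt-AtomisticToContinuum-16624`) for the crux
`Summit.AtomisticToContinuum.HydrodynamicLimit.Theses.TwoClocks.TransferActivityTails` (route TwoClocks, rank 7),
skeleton `Cruxes/TransferActivityTails/Lines/Sketch.lean`.  The COMPOSITION of the line: from the abstract drift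
engine (`DriftEngine`), the a.e.-measurability of the block activity (`BlockActAEMeasurable`), the block-average
identity and the window sandwich on the good set (`BlockAverage`, `WindowSandwich`), the dynamical posits (CD)
`PredictorDrift` and (UI₁) `OneBlockUI`, the crux follows (`stub_driftTransfer : DriftTransfer`).

Proof.  `σ₀ := min` of the thresholds of (CD), (UI₁), of the local-Gibbs LLN (probability measures) and `1/2`
(a.e.-measurability).  Given `σ, T`, the Euler solution, the flows, the `t = 0` LLN and `t < T`: (CD) gives
`τ₁, ρ, C, L`; put `V_e := 4(C+1)/(1−ρ)` and `V₀ := 2V_e`.  Given `V ≥ V₀`, `ε > 0`: (UI₁) at accuracy `ε/4` gives a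
level `M'`, at accuracy `δ := ε/(8(M'+1))` a level `M`; choose `K₀ ≥ L` with `2M'(L(M+1) + M²/4) ≤ (ε/4)(K₀+1)` and
`τ₀ := (K₀+1)τ₁`.  For `τ ≥ τ₀` let `K := ⌊τ/τ₁⌋ ≥ K₀ + 1`, so `Kτ₁ ≤ τ < (K+1)τ₁`; take `N₀` from (CD) and (UI₁)
at `K + 1` blocks.  For `N ≥ N₀`, `s ≤ t`, a.e. (good set): the window activity satisfies
`a_i ≤ ((K+1)τ₁/τ) ā_i ≤ 2ā_i` with `ā_i = (K+1)⁻¹Σ_{j≤K} X_{i,j}` (sandwich + block average), hence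
`a_i𝟙{a_i > V} ≤ 2(ā_i − M')₊ + 2M'𝟙{ā_i > V_e}`; `E (ā_i − M')₊ ≤ (K+1)⁻¹Σ_j E(X_{i,j} − M')₊` (convexity), summed
over `i` this is `≤ (N+1)ε/4` by (UI₁); and by the ENGINE (per sphere, drift from (CD)) and MARKOV (averaged over
spheres, inputs from (UI₁)), `Σ_i P(ā_i > V_e) ≤ (N+1)(L(M+δ)/(K+1) + δ + M²/(4(K+1)))`.  Total `≤ ε`.
-/

noncomputable section

open MeasureTheory Filter Set Topology
open scoped ENNReal BigOperators

namespace Summit.AtomisticToContinuum.HydrodynamicLimit.Theorems.TransferActivityTailsDriftTransfer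

open Literature.MathematicalPhysics.KineticTheory Literature.Analysis.FluidPDE
open Summit.AtomisticToContinuum.HydrodynamicLimit.Theorems.TransferActivityTailsNegative
  (Flow Rec transferOf TailsOf transferActivityTails_iff transferOf_nonneg collisionSum_nonneg)
open Summit.AtomisticToContinuum.HydrodynamicLimit.Theorems.CollisionActivityTailsEndpointTails
  (Cfg window tailFn ae_mem_good_localGibbsLaw)
open Summit.AtomisticToContinuum.HydrodynamicLimit.Theorems.TransferActivityTailsDriftTransferFixedN
  (lintegral_tail_average_le)
open Summit.AtomisticToContinuum.HydrodynamicLimit.Theorems.TransferActivityTailsDriftEngine (DriftEngine)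
open Summit.AtomisticToContinuum.HydrodynamicLimit.Theorems.TransferActivityTailsDriftBlockActAEMeasurable
  (BlockAct BlockActAEMeasurable)
open Summit.AtomisticToContinuum.HydrodynamicLimit.Theorems.TransferActivityTailsDriftBlockAverage (BlockAverage)
open Summit.AtomisticToContinuum.HydrodynamicLimit.Theorems.TransferActivityTailsDriftWindowSandwich (WindowSandwich)

/-! ## Vocabulary of the line (verbatim from the registered skeleton `Lines/Sketch_a1.lean`)

`BlockAct`, `DriftEngine`, `BlockActAEMeasurable`, `BlockAverage`, `WindowSandwich` are the LANDED ones
(`…DriftBlockActAEMeasurable`, `…DriftEngine`, `…DriftBlockAverage`, `…DriftWindowSandwich`; the block activity of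
`…DriftBlockAverage` is a byte-identical copy of `…DriftBlockActAEMeasurable.BlockAct`, definitionally equal). -/

/-- The crux's frame (its quantifier prefix up to `∀ t ∈ Ico 0 T`), abstracted over the conclusion `Q σ t Φ P`
(`P N` = the local Gibbs law at time `0`; blocks are read along the true orbit, exactly as in the crux). -/
def InCruxFrame (Q : (σ : ℝ) → ℝ → ((N : ℕ) → Flow σ N) → ((N : ℕ) → Measure (Cfg N)) → Prop) : Prop :=
  ∀ (a₀ θ₀ : T3 → ℝ) (u₀ : T3 → V3), Continuous a₀ → Continuous θ₀ → Continuous u₀ →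
    (∀ x, 0 < a₀ x) → (∀ x, 0 < θ₀ x) → ∃ σ₀ : ℝ, 0 < σ₀ ∧ ∀ σ : ℝ, 0 < σ → σ < σ₀ →
    ∀ (T : ℝ) (ρ θ : ℝ → T3 → ℝ) (u : ℝ → T3 → V3), IsHardSphereEulerSolution σ T ρ u θ →
    ∀ Φ : (N : ℕ) → Flow σ N,
    TendstoHydroFieldsAt (fun N => localGibbsLaw σ a₀ u₀ θ₀ N (Φ N)) Φ ρ u θ 0 →
    ∀ t ∈ Set.Ico 0 T, Q σ t Φ (fun N => localGibbsLaw σ a₀ u₀ θ₀ N (Φ N))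

/-- **(CD) Predictor drift** (open stub `stub_predictorDrift` of `Lines/Sketch_a1.lean`; the line's dynamical posit, UNPROVED). -/
def PredictorDrift : Prop :=
  InCruxFrame fun σ t Φ P =>
    ∃ τ₁ : ℝ, 0 < τ₁ ∧ ∃ ρ : ℝ, 0 ≤ ρ ∧ ρ < 1 ∧ ∃ C : ℝ, 0 ≤ C ∧ ∃ L : ℕ, 1 ≤ L ∧
    ∀ K : ℕ, ∃ N₀ : ℕ, ∀ N : ℕ, N₀ ≤ N → ∀ s ∈ Set.Icc 0 t, ∀ i : Fin (N + 1),
    ∀ j : ℕ, L ≤ j + 1 → j + 1 < K →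
    ∀ g : (Fin (j + 1) → ℝ) → ℝ, Measurable g → (∀ y, 0 ≤ g y ∧ g y ≤ 1) →
      ∫⁻ z, ENNReal.ofReal (BlockAct σ τ₁ (Φ N) i (j + 1) s z *
          g (fun k => BlockAct σ τ₁ (Φ N) i k s z)) ∂(P N) ≤
      ∫⁻ z, ENNReal.ofReal ((ρ * ((L : ℝ)⁻¹ * ∑ k ∈ Finset.range L, BlockAct σ τ₁ (Φ N) i (j + 1 - L + k) s z)
          + C) * g (fun k => BlockAct σ τ₁ (Φ N) i k s z)) ∂(P N)

/-- **(UI₁) One-block uniform integrability** (open stub `stub_oneBlockUI` of `Lines/Sketch_a1.lean`; UNPROVED). -/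
def OneBlockUI : Prop :=
  InCruxFrame fun σ t Φ P =>
    ∀ τ₁ : ℝ, 0 < τ₁ → ∀ δ : ℝ, 0 < δ → ∃ M : ℝ, 0 ≤ M ∧ ∀ K : ℕ, ∃ N₀ : ℕ, ∀ N : ℕ, N₀ ≤ N →
    ∀ s ∈ Set.Icc 0 t, ∀ j : ℕ, j < K →
      ∫⁻ z, ENNReal.ofReal (((N : ℝ) + 1)⁻¹ * ∑ i : Fin (N + 1), max (BlockAct σ τ₁ (Φ N) i j s z - M) 0)
        ∂(P N) ≤ ENNReal.ofReal δ

/-- **The transfer** (registered stub `stub_driftTransfer`): engine + kinematics + (CD) + (UI₁) imply the crux. -/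
def DriftTransfer : Prop :=
  DriftEngine → BlockActAEMeasurable → BlockAverage → WindowSandwich → PredictorDrift → OneBlockUI →
    Summit.AtomisticToContinuum.HydrodynamicLimit.Theses.TwoClocks.TransferActivityTails

/-! ## The engine for a.e.-measurable sequences -/

/-- **The engine for a.e.-measurable sequences.**  `DriftEngine` is stated for measurable `X_j`; replacing each
`X_j` by a nonnegative measurable modification changes every integral and every event by a null set only. -/
theorem driftEngine_ae (hE : DriftEngine) (Ω : Type) [MeasurableSpace Ω] (P : Measure Ω) [IsProbabilityMeasure P]
    (K L : ℕ) (X : ℕ → Ω → ℝ) (ρ C M : ℝ) (hX : ∀ j, AEMeasurable (X j) P) (hX0 : ∀ j ω, 0 ≤ X j ω) (hρ0 : 0 ≤ ρ)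
    (hρ1 : ρ < 1) (hC : 0 ≤ C) (hL : 1 ≤ L) (hLK : L < K) (hM : 0 ≤ M)
    (hdrift : ∀ j : ℕ, L ≤ j + 1 → j + 1 < K → ∀ g : (Fin (j + 1) → ℝ) → ℝ, Measurable g →
      (∀ y, 0 ≤ g y ∧ g y ≤ 1) →
      ∫⁻ ω, ENNReal.ofReal (X (j + 1) ω * g (fun k => X k ω)) ∂P ≤
      ∫⁻ ω, ENNReal.ofReal ((ρ * ((L : ℝ)⁻¹ * ∑ k ∈ Finset.range L, X (j + 1 - L + k) ω) + C) *
        g (fun k => X k ω)) ∂P) :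
    P {ω | 4 * (C + 1) / (1 - ρ) < (K : ℝ)⁻¹ * ∑ j ∈ Finset.range K, X j ω} ≤
      P {ω | (K : ℝ) ≤ ∑ j ∈ Finset.range L, X j ω} +
        P {ω | (K : ℝ) ≤ ∑ j ∈ Finset.range K, max (X j ω - M) 0} +
        ENNReal.ofReal (M ^ 2 / (4 * K)) := by
  -- nonnegative measurable modifications
  set X' : ℕ → Ω → ℝ := fun j ω => max ((hX j).mk (X j) ω) 0 with hX'
  have hX'm : ∀ j, Measurable (X' j) := fun j => (hX j).measurable_mk.max measurable_const
  have hX'0 : ∀ j ω, 0 ≤ X' j ω := fun j ω => le_max_right _ _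
  have hae : ∀ᵐ ω ∂P, ∀ j, X' j ω = X j ω := by
    rw [ae_all_iff]
    intro j
    filter_upwards [(hX j).ae_eq_mk] with ω hω
    simp only [hX', ← hω, max_eq_left (hX0 j ω)]
  -- the drift hypothesis transfers
  have hdrift' : ∀ j : ℕ, L ≤ j + 1 → j + 1 < K → ∀ g : (Fin (j + 1) → ℝ) → ℝ, Measurable g →
      (∀ y, 0 ≤ g y ∧ g y ≤ 1) →
      ∫⁻ ω, ENNReal.ofReal (X' (j + 1) ω * g (fun k => X' k ω)) ∂P ≤
      ∫⁻ ω, ENNReal.ofReal ((ρ * ((L : ℝ)⁻¹ * ∑ k ∈ Finset.range L, X' (j + 1 - L + k) ω) + C) *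
        g (fun k => X' k ω)) ∂P := by
    intro j hj hjK g hg hg01
    have h1 : (fun ω => ENNReal.ofReal (X' (j + 1) ω * g (fun k => X' k ω))) =ᵐ[P]
        fun ω => ENNReal.ofReal (X (j + 1) ω * g (fun k => X k ω)) := by
      filter_upwards [hae] with ω hω
      simp only [hω]
    have h2 : (fun ω => ENNReal.ofReal ((ρ * ((L : ℝ)⁻¹ * ∑ k ∈ Finset.range L, X' (j + 1 - L + k) ω) + C) *
        g (fun k => X' k ω))) =ᵐ[P]
        fun ω => ENNReal.ofReal ((ρ * ((L : ℝ)⁻¹ * ∑ k ∈ Finset.range L, X (j + 1 - L + k) ω) + C) *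
        g (fun k => X k ω)) := by
      filter_upwards [hae] with ω hω
      simp only [hω]
    rw [lintegral_congr_ae h1, lintegral_congr_ae h2]
    exact hdrift j hj hjK g hg hg01
  have key := hE Ω P K L X' ρ C M hX'm hX'0 hρ0 hρ1 hC hL hLK hM hdrift'
  -- the events agree up to null sets
  have e0 : {ω | 4 * (C + 1) / (1 - ρ) < (K : ℝ)⁻¹ * ∑ j ∈ Finset.range K, X j ω} =ᵐ[P]
      {ω | 4 * (C + 1) / (1 - ρ) < (K : ℝ)⁻¹ * ∑ j ∈ Finset.range K, X' j ω} := by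
    filter_upwards [hae] with ω hω
    change (4 * (C + 1) / (1 - ρ) < (K : ℝ)⁻¹ * ∑ j ∈ Finset.range K, X j ω) =
      (4 * (C + 1) / (1 - ρ) < (K : ℝ)⁻¹ * ∑ j ∈ Finset.range K, X' j ω)
    simp only [hω]
  have e1 : {ω | (K : ℝ) ≤ ∑ j ∈ Finset.range L, X' j ω} =ᵐ[P] {ω | (K : ℝ) ≤ ∑ j ∈ Finset.range L, X j ω} := by
    filter_upwards [hae] with ω hω
    change ((K : ℝ) ≤ ∑ j ∈ Finset.range L, X' j ω) = ((K : ℝ) ≤ ∑ j ∈ Finset.range L, X j ω)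
    simp only [hω]
  have e2 : {ω | (K : ℝ) ≤ ∑ j ∈ Finset.range K, max (X' j ω - M) 0} =ᵐ[P]
      {ω | (K : ℝ) ≤ ∑ j ∈ Finset.range K, max (X j ω - M) 0} := by
    filter_upwards [hae] with ω hω
    change ((K : ℝ) ≤ ∑ j ∈ Finset.range K, max (X' j ω - M) 0) =
      ((K : ℝ) ≤ ∑ j ∈ Finset.range K, max (X j ω - M) 0)
    simp only [hω]
  rw [measure_congr e0, ← measure_congr e1, ← measure_congr e2]
  exact key

/-! ## §3 The transfer -/

/-- **Stub 7 of line `Sketch` (registered): the transfer.**  Engine + a.e.-measurability + block average + window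
sandwich + (CD) + (UI₁) imply the crux `TwoClocks.TransferActivityTails` (see the module docstring for the proof). -/
theorem stub_driftTransfer : DriftTransfer := by
  intro hE hMeas hAvg hSand hCD hUI
  rw [transferActivityTails_iff]
  intro a₀ θ₀ u₀ ha hθ hu ha0 hθ0
  obtain ⟨σ₁, hσ₁, H1⟩ := hCD a₀ θ₀ u₀ ha hθ hu ha0 hθ0
  obtain ⟨σ₂, hσ₂, H2⟩ := hUI a₀ θ₀ u₀ ha hθ hu ha0 hθ0
  obtain ⟨σ₃, hσ₃, H3⟩ := localGibbs_lln_holds a₀ θ₀ u₀ ha hθ hu ha0 hθ0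
  refine ⟨min (min σ₁ σ₂) (min σ₃ 2⁻¹), lt_min (lt_min hσ₁ hσ₂) (lt_min hσ₃ (by norm_num)), ?_⟩
  intro σ hσ hσlt T ρ θ u hEul Φ hlim t ht
  have hσ1 : σ < σ₁ := hσlt.trans_le ((min_le_left _ _).trans (min_le_left _ _))
  have hσ2 : σ < σ₂ := hσlt.trans_le ((min_le_left _ _).trans (min_le_right _ _))
  have hσ3 : σ < σ₃ := hσlt.trans_le ((min_le_right _ _).trans (min_le_left _ _))
  have hσh : σ < 2⁻¹ := hσlt.trans_le ((min_le_right _ _).trans (min_le_right _ _))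
  obtain ⟨τ₁, hτ₁, ρ', hρ0, hρ1, C, hC, L, hL, HK⟩ := H1 σ hσ hσ1 T ρ θ u hEul Φ hlim t ht
  have HU := H2 σ hσ hσ2 T ρ θ u hEul Φ hlim t ht
  obtain ⟨ρ₀, -, -, Hprob⟩ := H3 σ hσ hσ3
  have hP : ∀ N, IsProbabilityMeasure (localGibbsLaw σ a₀ u₀ θ₀ N (Φ N)) := (Hprob Φ).1
  -- the engine's threshold and the crux's `V₀`
  have h1ρ : 0 < 1 - ρ' := by linarith
  set Ve : ℝ := 4 * (C + 1) / (1 - ρ') with hVe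
  have hVe0 : 0 < Ve := by positivity
  refine ⟨2 * Ve, by positivity, ?_⟩
  intro V hV ε hε
  -- the two levels from (UI₁)
  obtain ⟨M', hM'0, HM'⟩ := HU τ₁ hτ₁ (ε / 4) (by positivity)
  set δ : ℝ := ε / (8 * (M' + 1)) with hδ
  have hδ0 : 0 < δ := by positivity
  obtain ⟨M, hM0, HM⟩ := HU τ₁ hτ₁ δ hδ0
  -- the number of blocks
  set A : ℝ := 2 * M' * (L * (M + δ) + M ^ 2 / 4) with hA
  have hA0 : 0 ≤ A := by positivity
  obtain ⟨K₀, hK₀L, hK₀A⟩ : ∃ K₀ : ℕ, (L : ℝ) ≤ K₀ ∧ A ≤ ε / 4 * ((K₀ : ℝ) + 1) := by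
    obtain ⟨m, hm⟩ := exists_nat_ge (max (L : ℝ) (A / (ε / 4)))
    refine ⟨m, (le_max_left _ _).trans hm, ?_⟩
    have h1 : A / (ε / 4) ≤ m := (le_max_right _ _).trans hm
    rw [div_le_iff₀ (by positivity)] at h1
    have h4 : 0 ≤ ε / 4 := by positivity
    nlinarith
  refine ⟨((K₀ : ℝ) + 1) * τ₁, by positivity, ?_⟩
  intro τ hτ
  have hτpos : 0 < τ := lt_of_lt_of_le (by positivity) hτ
  -- `K := ⌊τ/τ₁⌋` (kept opaque: an unfolded `Nat.floor` on `ℝ` makes `whnf` diverge)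
  obtain ⟨K, hKdef⟩ : ∃ K : ℕ, K = ⌊τ / τ₁⌋₊ := ⟨_, rfl⟩
  have hKτ : (K : ℝ) * τ₁ ≤ τ := by
    have h := Nat.floor_le (div_nonneg hτpos.le hτ₁.le) (R := ℝ) (a := τ / τ₁)
    rw [← hKdef, le_div_iff₀ hτ₁] at h
    exact h
  have hτK : τ ≤ ((K : ℝ) + 1) * τ₁ := by
    have h := (Nat.lt_floor_add_one (τ / τ₁)).le
    rw [← hKdef, div_le_iff₀ hτ₁] at h
    exact h
  have hK₀K : K₀ + 1 ≤ K := by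
    rw [hKdef]
    refine Nat.le_floor ?_
    rw [le_div_iff₀ hτ₁]
    exact_mod_cast hτ
  have hK1 : 1 ≤ K := le_trans (Nat.le_add_left 1 K₀) hK₀K
  have hLK₀ : L ≤ K₀ := by exact_mod_cast hK₀L
  have hLK : L < K + 1 := by omega
  have hKpos : (0 : ℝ) < (K : ℝ) + 1 := by positivity
  -- `N₀`
  obtain ⟨N₁, HN1⟩ := HK (K + 1)
  obtain ⟨N₂, HN2⟩ := HM' (K + 1)
  obtain ⟨N₃, HN3⟩ := HM (K + 1)
  refine ⟨max N₁ (max N₂ N₃), ?_⟩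
  intro N hN s hs
  have hN1 : N₁ ≤ N := (le_max_left _ _).trans hN
  have hN2 : N₂ ≤ N := ((le_max_left _ _).trans (le_max_right _ _)).trans hN
  have hN3 : N₃ ≤ N := ((le_max_right _ _).trans (le_max_right _ _)).trans hN
  -- specialise the three inputs to `N, s` and drop the frame hypotheses
  have hCD1 := HN1 N hN1 s hs
  have hUI2 := HN2 N hN2 s hs
  have hUI3 := HN3 N hN3 s hs
  have hPN : IsProbabilityMeasure (localGibbsLaw σ a₀ u₀ θ₀ N (Φ N)) := hP N
  clear HN1 HN2 HN3 HK HU H1 H2 H3 Hprob hP hlim hEul hCD hUI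
  -- the block activities of this `N, s`
  set X : Fin (N + 1) → ℕ → Cfg N → ℝ := fun i j z => BlockAct σ τ₁ (Φ N) i j s z with hXdef
  have hXm : ∀ i j, AEMeasurable (X i j) (localGibbsLaw σ a₀ u₀ θ₀ N (Φ N)) := fun i j =>
    hMeas σ hσ hσh a₀ θ₀ u₀ N (Φ N) τ₁ s i j
  have hκ : 0 ≤ σ / τ₁ := div_nonneg hσ.le hτ₁.le
  have hX0 : ∀ i j z, 0 ≤ X i j z := fun i j z =>
    mul_nonneg hκ (collisionSum_nonneg (Φ N) _ (transferOf_nonneg N i) z)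
  -- the per-sphere exceedance bound from the engine and (CD)
  have hexc : ∀ i, localGibbsLaw σ a₀ u₀ θ₀ N (Φ N)
        {z | Ve < ((K : ℝ) + 1)⁻¹ * ∑ j ∈ Finset.range (K + 1), X i j z} ≤
      localGibbsLaw σ a₀ u₀ θ₀ N (Φ N) {z | ((K : ℝ) + 1) ≤ ∑ j ∈ Finset.range L, X i j z} +
        localGibbsLaw σ a₀ u₀ θ₀ N (Φ N) {z | ((K : ℝ) + 1) ≤ ∑ j ∈ Finset.range (K + 1), max (X i j z - M) 0} +
        ENNReal.ofReal (M ^ 2 / (4 * ((K : ℝ) + 1))) := by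
    intro i
    have key := driftEngine_ae hE (Cfg N) (localGibbsLaw σ a₀ u₀ θ₀ N (Φ N)) (K + 1) L (X i) ρ' C M (hXm i)
      (hX0 i) hρ0 hρ1 hC hL hLK hM0 (fun j hj hjK g' hg' hg'01 => hCD1 i j hj hjK g' hg' hg'01)
    push_cast at key
    exact key
  -- the a.e. domination `a_i ≤ 2 ā_i` (sandwich + block average, on the good set)
  have hdom : ∀ᵐ z ∂(localGibbsLaw σ a₀ u₀ θ₀ N (Φ N)), ∀ i : Fin (N + 1),
      σ / τ * (Φ N).collisionSum (Set.Ioc s (s + window τ N)) (transferOf N i) z ≤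
        2 * (((K : ℝ) + 1)⁻¹ * ∑ j ∈ Finset.range (K + 1), X i j z) := by
    filter_upwards [ae_mem_good_localGibbsLaw σ a₀ θ₀ u₀ N (Φ N)] with z hz
    intro i
    have hsand := hSand σ N (Φ N) z hz s i τ (((K : ℝ) + 1) * τ₁) hτpos.le hτK
    have havg := hAvg σ N (Φ N) z hz τ₁ hτ₁ s i K
    have hCS0 : 0 ≤ (Φ N).collisionSum (Set.Ioc s (s + window (((K : ℝ) + 1) * τ₁) N)) (transferOf N i) z :=
      collisionSum_nonneg (Φ N) _ (transferOf_nonneg N i) z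
    have hratio : σ / τ ≤ 2 * (σ / (((K : ℝ) + 1) * τ₁)) := by
      have hK1' : (1 : ℝ) ≤ K := by exact_mod_cast hK1
      have hD : 0 < ((K : ℝ) + 1) * τ₁ := by positivity
      have h2τ : ((K : ℝ) + 1) * τ₁ ≤ 2 * τ := by nlinarith [hKτ, hK1', hτ₁.le]
      rw [div_le_iff₀ hτpos]
      have hone : 1 ≤ 2 * τ / (((K : ℝ) + 1) * τ₁) := by
        rw [le_div_iff₀ hD]
        linarith
      calc σ ≤ σ * (2 * τ / (((K : ℝ) + 1) * τ₁)) := le_mul_of_one_le_right hσ.le hone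
        _ = 2 * (σ / (((K : ℝ) + 1) * τ₁)) * τ := by ring
    calc σ / τ * (Φ N).collisionSum (Set.Ioc s (s + window τ N)) (transferOf N i) z
        ≤ σ / τ * (Φ N).collisionSum (Set.Ioc s (s + window (((K : ℝ) + 1) * τ₁) N)) (transferOf N i) z :=
          mul_le_mul_of_nonneg_left hsand (div_nonneg hσ.le hτpos.le)
      _ ≤ 2 * (σ / (((K : ℝ) + 1) * τ₁)) *
            (Φ N).collisionSum (Set.Ioc s (s + window (((K : ℝ) + 1) * τ₁) N)) (transferOf N i) z :=
          mul_le_mul_of_nonneg_right hratio hCS0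
      _ = 2 * (((K : ℝ) + 1)⁻¹ * ∑ j ∈ Finset.range (K + 1), X i j z) := by
          rw [mul_assoc, havg]
          -- the two landed copies of `BlockAct` (BlockAverage's and BlockActAEMeasurable's) agree definitionally
          rfl
  -- the real arithmetic: total ≤ ε
  have hreal : 2 * (ε / 4) + 2 * M' * (L * (M + δ) / ((K : ℝ) + 1) + δ + M ^ 2 / (4 * ((K : ℝ) + 1))) ≤ ε := by
    have hK₀K' : (K₀ : ℝ) + 1 ≤ K := by exact_mod_cast hK₀K
    have h1 : 2 * M' * δ ≤ ε / 4 := by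
      have hfrac : M' / (M' + 1) ≤ 1 := (div_le_one (by positivity)).2 (by linarith)
      calc 2 * M' * δ = ε / 4 * (M' / (M' + 1)) := by rw [hδ]; field_simp; ring
        _ ≤ ε / 4 * 1 := by gcongr
        _ = ε / 4 := mul_one _
    have h2 : 2 * M' * (L * (M + δ) / ((K : ℝ) + 1) + M ^ 2 / (4 * ((K : ℝ) + 1))) ≤ ε / 4 := by
      have hEq : 2 * M' * (L * (M + δ) / ((K : ℝ) + 1) + M ^ 2 / (4 * ((K : ℝ) + 1))) = A / ((K : ℝ) + 1) := by
        rw [hA]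
        field_simp
      rw [hEq, div_le_iff₀ hKpos]
      calc A ≤ ε / 4 * ((K₀ : ℝ) + 1) := hK₀A
        _ ≤ ε / 4 * ((K : ℝ) + 1) := by gcongr; linarith
    have hsplit : 2 * M' * (L * (M + δ) / ((K : ℝ) + 1) + δ + M ^ 2 / (4 * ((K : ℝ) + 1))) =
        2 * M' * δ + 2 * M' * (L * (M + δ) / ((K : ℝ) + 1) + M ^ 2 / (4 * ((K : ℝ) + 1))) := by ring
    rw [hsplit]
    linarith
  -- conclude with the fixed-`N` assembly
  haveI : IsProbabilityMeasure (localGibbsLaw σ a₀ u₀ θ₀ N (Φ N)) := hPN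
  have hmain := lintegral_tail_average_le (P := localGibbsLaw σ a₀ u₀ θ₀ N (Φ N)) hXm hX0
    (fun i z => σ / τ * (Φ N).collisionSum (Set.Ioc s (s + window τ N)) (transferOf N i) z) K L hLK.le hV
    hM0 hM'0 hδ0.le (by positivity : (0 : ℝ) ≤ ε / 4) hdom hUI2 hUI3 hexc
  exact hmain.trans (ENNReal.ofReal_le_ofReal hreal)

end Summit.AtomisticToContinuum.HydrodynamicLimit.Theorems.TransferActivityTailsDriftTransfer

end
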